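import Summits.ResolutionOfSingularities.ResolutionOfSingularities.Theorems.FrobeniusLadderFInjectiveMacaulayficationProp44TidyPieces
import Literature.AlgebraicGeometry.Resolution.CurveCentreTwoParameters
import Literature.AlgebraicGeometry.Resolution.GenericPointStalkData
import Literature.AlgebraicGeometry.Resolution.FibreComponentsBaseChange
import Literature.AlgebraicGeometry.Resolution.EmbeddedResolutionExcellentSurfaces
import Literature.AlgebraicGeometry.Resolution.QuasiExcellentClosedSubschemes
import Literature.AlgebraicGeometry.Resolution.ResolutionOfComponentsRegularLocus
import Literature.AlgebraicGeometry.Resolution.ComponentGluing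
import Literature.AlgebraicGeometry.Resolution.AlterationsSectionDivisor
import Literature.AlgebraicGeometry.Resolution.QuasiExcellentSchemes
import HarnessLib

/-!
# [CoP1] Prop. 4.4, steps 1–3 — the one-dimensional components of `Σ` (glue for `stub_reachTidy`)

[AI: prover `res-inputs-p-5a` (cell res-hironaka; F-71 census row L2 = skeleton v5.2 `stub_reachTidy`, glue (g2) of the
REACH decomposition). Helper lemmas about the curves of the order-`μ` locus at a stage of the algorithm of
Cossart–Piltant 2008, Prop. 4.4, in the vocabulary of the termination brick `false_of_badPointChain_of_curveConfiguration`
(res-inputs-p-9a): the reduced subscheme of the closure of a point of codimension `2`, regularity of its points read in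
the ambient local rings, and regular parameters at a regular point of such a curve. Not a statement of the manuscript
under adjudication. AI-written; AI review is weaker than expert review.]

* `isRegularLocalRing_stalk_subscheme_iff` — the local ring of `V(I)` at `v` is regular iff `𝒪_{X,v}/I_v` is.
* `not_mem_image_compl_regularLocus_iff` — for `x ∈ C`: `x` is not in the image of the singular locus of `V(𝓘_C)` iff
  `𝒪_{X,x}/𝓘_{C,x}` is a regular local ring; `not_mem_image_compl_regularLocus_self` — the generic point of `cl{ζ}` is
  never singular; `isRegular_subscheme_of_forall_not_mem` — no singular point ⇒ `V(𝓘_C)` regular.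
* `exists_rsopPair_of_isRegularLocalRing_quotient` — at a point `x ≠ η` of `cl{η}` (`codim η > 1`, `codim x ≤ 3`) where
  `𝒪_{X,x}/𝓘_{cl η,x}` is regular, `𝓘_{cl η,x}` is generated by two members of a regular system of parameters (the
  pointwise form of `exists_isRsopPart_fin_two_of_specializes`). [cite: Matsumura1987, Thm. 14.2]
* `isNoetherian_subscheme_closure`, `isQuasiExcellent_subscheme_closure`, `isIntegral_subscheme_closure`,
  `topologicalKrullDim_subscheme_closure_eq_one` — the reduced curve `V(𝓘_{cl ζ})` for `codim ζ = 2`, `ζ` not closed, on a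
  Noetherian quasi-excellent scheme of dimension `≤ 3`.
-/

-- `Summit.<Summit>.<Sub>.Theorems` with `Sub = Summit` (single-conjunct summit, D-0017)
set_option linter.dupNamespace false

noncomputable section

open CategoryTheory CategoryTheory.Limits AlgebraicGeometry TopologicalSpace IsLocalRing
open Literature.AlgebraicGeometry.Resolution Scheme.IdealSheafData

namespace Summit.ResolutionOfSingularities.ResolutionOfSingularities.Theorems

namespace CP2008Prop44

universe u

variable {X : Scheme.{u}}

/-! ## §1 Regularity of the points of a closed subscheme, read in the ambient local rings -/

/-- **`𝒪_{V(I),v} ≅ 𝒪_{X,v}/I_v`**: the local ring of the closed subscheme `V(I)` at `v` is regular iff the quotient of the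
ambient local ring by the stalk of `I` is. [folklore] -/
theorem isRegularLocalRing_stalk_subscheme_iff (I : X.IdealSheafData) (v : I.subscheme) :
    IsRegularLocalRing (I.subscheme.presheaf.stalk v) ↔
      IsRegularLocalRing (X.presheaf.stalk (I.subschemeι v) ⧸ stalkIdeal I (I.subschemeι v)) := by
  have hker : stalkIdeal I (I.subschemeι v) = RingHom.ker (I.subschemeι.stalkMap v).hom := by
    have h := stalkIdeal_ker_eq_ker_stalkMap I.subschemeι v
    rwa [ker_subschemeι] at h
  have hsurj : Function.Surjective (I.subschemeι.stalkMap v).hom := I.subschemeι.stalkMap_surjective v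
  let e : (X.presheaf.stalk (I.subschemeι v) ⧸ stalkIdeal I (I.subschemeι v)) ≃+* I.subscheme.presheaf.stalk v :=
    (Ideal.quotEquivOfEq hker).trans (RingHom.quotientKerEquivOfSurjective hsurj)
  exact ⟨fun h => IsRegularLocalRing.of_ringEquiv e.symm, fun h => IsRegularLocalRing.of_ringEquiv e⟩

/-- For `x ∈ C`: **`x` is not the image of a singular point of `V(𝓘_C)` iff `𝒪_{X,x}/𝓘_{C,x}` is a regular local ring.**
[folklore] -/
theorem not_mem_image_compl_regularLocus_iff (C : Closeds X) {x : X} (hx : x ∈ (C : Set X)) :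
    x ∉ (vanishingIdeal C).subschemeι '' (Scheme.regularLocus (vanishingIdeal C).subscheme)ᶜ ↔
      IsRegularLocalRing (X.presheaf.stalk x ⧸ stalkIdeal (vanishingIdeal C) x) := by
  have hxr : x ∈ Set.range (vanishingIdeal C).subschemeι := by
    rw [ComponentGluing.range_subschemeι_vanishingIdeal]
    exact hx
  obtain ⟨v, rfl⟩ := hxr
  constructor
  · intro h
    have hv : v ∈ Scheme.regularLocus (vanishingIdeal C).subscheme := by
      by_contra hv
      exact h ⟨v, hv, rfl⟩
    exact (isRegularLocalRing_stalk_subscheme_iff _ v).mp hv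
  · rintro h ⟨w, hw, hwv⟩
    have hwv' : w = v := (vanishingIdeal C).subschemeι.isClosedEmbedding.injective hwv
    subst hwv'
    exact hw ((isRegularLocalRing_stalk_subscheme_iff _ w).mpr h)

/-- **The generic point of `cl{ζ}` is a regular point of `V(𝓘_{cl ζ})`** (its local ring is the residue field `κ(ζ)`).
[folklore] -/
theorem not_mem_image_compl_regularLocus_self (ζ : X) :
    ζ ∉ (vanishingIdeal (⟨closure {ζ}, isClosed_closure⟩ : Closeds X)).subschemeι ''
      (Scheme.regularLocus (vanishingIdeal (⟨closure {ζ}, isClosed_closure⟩ : Closeds X)).subscheme)ᶜ := by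
  rw [not_mem_image_compl_regularLocus_iff _ (show ζ ∈ closure ({ζ} : Set X) from subset_closure (Set.mem_singleton ζ)),
    stalkIdeal_vanishingIdeal_closure_self]
  exact inferInstanceAs (IsRegularLocalRing (ResidueField _))

/-- **No singular point ⇒ the reduced subscheme is regular.** [folklore] -/
theorem isRegular_subscheme_of_forall_not_mem (C : Closeds X)
    (h : ∀ x ∈ (C : Set X), x ∉ (vanishingIdeal C).subschemeι '' (Scheme.regularLocus (vanishingIdeal C).subscheme)ᶜ) :
    Scheme.IsRegular (vanishingIdeal C).subscheme := by
  intro v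
  have hx : (vanishingIdeal C).subschemeι v ∈ (C : Set X) := by
    rw [← ComponentGluing.range_subschemeι_vanishingIdeal C]
    exact ⟨v, rfl⟩
  by_contra hv
  exact h _ hx ⟨v, hv, rfl⟩

/-- Conversely a regular subscheme has no singular point. [folklore] -/
theorem forall_not_mem_of_isRegular_subscheme (C : Closeds X) (h : Scheme.IsRegular (vanishingIdeal C).subscheme) (x : X) :
    x ∉ (vanishingIdeal C).subschemeι '' (Scheme.regularLocus (vanishingIdeal C).subscheme)ᶜ := by
  rintro ⟨v, hv, -⟩
  exact hv (h v)

/-! ## §2 Two regular parameters at a regular point of a curve through a threefold point -/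

/-- **A curve `cl{η}` of codimension `2` whose reduced structure is regular AT the point `x ≠ η` (i.e. `𝒪_{X,x}/𝓘_{cl η,x}`
regular, `codim x ≤ 3`, `𝒪_{X,x}` regular) is cut out at `x` by two members of a regular system of parameters** — the
pointwise form of `exists_isRsopPart_fin_two_of_specializes` (Matsumura 14.2 plus the dimension count `1 + 2 = 3`).
[cite: Matsumura1987, Thm. 14.2] [cite: CossartPiltant2008, proof of Prop. 4.2] -/
theorem exists_rsopPair_of_isRegularLocalRing_quotient [IsLocallyNoetherian X] {η x : X}
    (hηx : η ⤳ x) (hxη : ¬ x ⤳ η) (hη : 1 < Order.coheight η) (hx3 : Order.coheight x ≤ 3)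
    [IsRegularLocalRing (X.presheaf.stalk x)]
    (hq : IsRegularLocalRing (X.presheaf.stalk x ⧸
      stalkIdeal (vanishingIdeal (⟨closure {η}, isClosed_closure⟩ : Closeds X)) x)) :
    ∃ c : Fin 2 → X.presheaf.stalk x, IsRsopPart c ∧
      Ideal.span (Set.range c) = stalkIdeal (vanishingIdeal (⟨closure {η}, isClosed_closure⟩ : Closeds X)) x := by
  obtain ⟨hcη, hcx⟩ := coheight_eq_two_of_specializes hηx hxη hη hx3
  have hP : stalkIdeal (vanishingIdeal (⟨closure {η}, isClosed_closure⟩ : Closeds X)) x = primeOfSpecializes hηx :=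
    stalkIdeal_vanishingIdeal_closure hηx
  have hPh : (primeOfSpecializes hηx).height = 2 := by
    have h := coe_height_primeOfSpecializes hηx
    rw [hcη] at h
    exact_mod_cast h
  have hdimx : ringKrullDim (X.presheaf.stalk x) = 3 := by
    rw [ringKrullDim_stalk_eq_coheight, hcx]
    rfl
  haveI hRq : IsRegularLocalRing (X.presheaf.stalk x ⧸ primeOfSpecializes hηx) := hP ▸ hq
  -- `𝓘 = (c_1, …, c_r)`, `c` part of a regular system of parameters, `dim 𝒪/𝔭_η + r = 3`
  obtain ⟨r, c, hcr, hcY⟩ := exists_isRsopPart_span_range_eq (R := X.presheaf.stalk x) (P := primeOfSpecializes hηx)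
    (IsLocalRing.le_maximalIdeal (Ideal.IsPrime.ne_top inferInstance))
  have hq' := hcr.ringKrullDim_quotient_add
  rw [hcY, hdimx] at hq'
  have hup := ringKrullDim_quotient_add_natCast_le_of_height_eq (primeOfSpecializes hηx) hPh
  rw [hdimx] at hup
  obtain ⟨k, hk⟩ := exists_nat_cast_eq_ringKrullDim (R := X.presheaf.stalk x ⧸ primeOfSpecializes hηx)
  have hk0 : k ≠ 0 := by
    rintro rfl
    haveI : Ring.KrullDimLE 0 (X.presheaf.stalk x ⧸ primeOfSpecializes hηx) :=
      (ringKrullDimZero_iff_ringKrullDim_eq_zero).mpr (by exact_mod_cast hk)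
    have hf := Ring.KrullDimLE.isField_of_isDomain (R := X.presheaf.stalk x ⧸ primeOfSpecializes hηx)
    have hmax := Ideal.Quotient.maximal_of_isField _ hf
    have heq := IsLocalRing.eq_maximalIdeal hmax
    have h3 := IsLocalRing.maximalIdeal_height_eq_ringKrullDim (R := X.presheaf.stalk x)
    rw [← heq, hPh, hdimx] at h3
    exact absurd h3 (by decide)
  rw [hk] at hq' hup
  have h1 : ((k + r : ℕ) : WithBot ℕ∞) = 3 := by push_cast; exact hq'
  have h2 : ((k + 2 : ℕ) : WithBot ℕ∞) ≤ 3 := by push_cast; exact hup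
  have h1' : k + r = 3 := by exact_mod_cast h1
  have h2' : k + 2 ≤ 3 := by exact_mod_cast h2
  obtain rfl : r = 2 := by omega
  exact ⟨c, hcr, hP ▸ hcY⟩

/-! ## §3 The reduced curve on the closure of a point of codimension `2` -/

/-- `V(𝓘_{cl ζ})` is Noetherian on a Noetherian scheme. [folklore] -/
theorem isNoetherian_subscheme_closure [IsNoetherian X] (ζ : X) :
    IsNoetherian (vanishingIdeal (⟨closure {ζ}, isClosed_closure⟩ : Closeds X)).subscheme :=
  isNoetherian_subscheme _

/-- `V(𝓘_{cl ζ})` is quasi-excellent on a quasi-excellent locally Noetherian scheme. [cite: Matsumura1987, §32 p. 260] -/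
theorem isQuasiExcellent_subscheme_closure [IsLocallyNoetherian X] (hqe : Scheme.IsQuasiExcellent X) (ζ : X) :
    Scheme.IsQuasiExcellent (vanishingIdeal (⟨closure {ζ}, isClosed_closure⟩ : Closeds X)).subscheme :=
  Scheme.IsQuasiExcellent.of_isClosedImmersion (vanishingIdeal (⟨closure {ζ}, isClosed_closure⟩ : Closeds X)).subschemeι hqe

/-- `V(𝓘_{cl ζ})` is an integral scheme. [folklore] -/
theorem isIntegral_subscheme_closure (ζ : X) :
    IsIntegral (vanishingIdeal (⟨closure {ζ}, isClosed_closure⟩ : Closeds X)).subscheme :=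
  ComponentGluing.isIntegral_subscheme_vanishingIdeal _ isIrreducible_singleton.closure

/-- **`dim V(𝓘_{cl ζ}) = 1`** for a point `ζ` of codimension `2` that is not a closed point, on a scheme of dimension `≤ 3`
(`dim cl{ζ} = height ζ`, `height ζ + codim ζ ≤ dim X ≤ 3`, and `height ζ ≥ 1` as `ζ` has a proper specialisation).
[cite: StacksProject, Tag 02I4] -/
theorem topologicalKrullDim_subscheme_closure_eq_one (hX3 : topologicalKrullDim X ≤ 3) {ζ : X}
    (hcoh : Order.coheight ζ = 2) (hcl : ¬ IsClosed ({ζ} : Set X)) :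
    topologicalKrullDim (vanishingIdeal (⟨closure {ζ}, isClosed_closure⟩ : Closeds X)).subscheme = 1 := by
  rw [topologicalKrullDim_subscheme_vanishingIdeal]
  change topologicalKrullDim (closure ({ζ} : Set X)) = 1
  rw [topologicalKrullDim_closure_singleton_eq_height]
  -- `height ζ ≤ 1`
  have hle : Order.height ζ + Order.coheight ζ ≤ 3 := by
    have h0 : Order.height ζ + Order.coheight ζ ≤ ⨆ a : X, (Order.height a + Order.coheight a) :=
      le_iSup (fun a : X => Order.height a + Order.coheight a) ζ
    have h1 : ((Order.height ζ + Order.coheight ζ : ℕ∞) : WithBot ℕ∞) ≤ Order.krullDim X := by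
      haveI : Nonempty X := ⟨ζ⟩
      rw [Order.krullDim_eq_iSup_height_add_coheight_of_nonempty]
      exact_mod_cast h0
    rw [← topologicalKrullDim_eq_krullDim_carrier] at h1
    have h2 : ((Order.height ζ + Order.coheight ζ : ℕ∞) : WithBot ℕ∞) ≤ ((3 : ℕ∞) : WithBot ℕ∞) := h1.trans hX3
    exact WithBot.coe_le_coe.mp h2
  rw [hcoh] at hle
  -- `height ζ ≥ 1`: a proper specialisation of `ζ` exists
  have hpos : 0 < Order.height ζ := by
    rw [Order.height_pos]
    intro hmin
    apply hcl
    have hsub : closure ({ζ} : Set X) ⊆ {ζ} := by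
      intro z hz
      have hsp : ζ ⤳ z := specializes_iff_mem_closure.mpr hz
      have hle' : z ≤ ζ := Scheme.le_iff_specializes.mpr hsp
      have hζz : ζ ≤ z := hmin hle'
      have heq : ζ = z := (hsp.antisymm (Scheme.le_iff_specializes.mp hζz)).eq
      rw [Set.mem_singleton_iff, heq]
    rw [← closure_subset_iff_isClosed]
    exact hsub
  have hfin : Order.height ζ ≠ ⊤ := by
    intro h
    rw [h] at hle
    exact absurd hle (by decide)
  obtain ⟨k, hk⟩ := ENat.ne_top_iff_exists.mp hfin
  rw [← hk] at hle hpos ⊢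
  have h1 : k + 2 ≤ 3 := by exact_mod_cast hle
  have h2 : 0 < k := by exact_mod_cast hpos
  have hk1 : k = 1 := by omega
  subst hk1
  rfl

end CP2008Prop44

end Summit.ResolutionOfSingularities.ResolutionOfSingularities.Theorems

end
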